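import Summits.QuantumFields.YangMills.Theorems.BalabanUVNodesN12TowerProxiesOfClass
import Literature.MathematicalPhysics.QuantumFieldTheory.Balaban1983to89.B15AveragingHolomorphicTowerRegion
import Literature.MathematicalPhysics.QuantumFieldTheory.Balaban1983to89.B15Prop1DatumSmall7AtZSequence

/-!
# DAG node N12 [B15] — THE PER-TOWER (0.4) GUARDS OF A (2.12)-CLASS CONFIGURATION AND OF THE PULL-BACK DATUM (LOCATED-E1-HSB repair step (r2)): at every constrained bond `(j, c)`
# of `𝐁_k(Z)` the configuration `U₀` ITSELF is (0.4)-guarded along the tower of `c` — no proxy, no global `SmallBelow` — as soon as `U₀` lies in the (2.12) class of record; and so is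
# ANY configuration plaquette-small on the tower box, in particular the datum `Q_k^{s*}V` wherever `V` is plaquette-small at scale `k`

[Balaban1985Variational] = «[15]», (2) p. 278, (82)–(83) p. 290, Prop. 9 (190) p. 309; [Balaban1988Convergent] = «[III]», (2.2) p. 255, (2.10)–(2.13) pp. 256–257;
[Balaban1987RG1] = «[I]», (0.4) p. 253, (0.21) p. 256; [BalabanImbrieJaffe1985] (4.5.3) p. 312; [Balaban1989LargeFieldI] = «[IV]», (1.74) p. 192, p. 193 ll. 14–20.

Cell `pub-ymgap`, HUMAN RULINGS D-0062 ∕ D-0149, lane owner `pub-ymgap-dag-n12-c` (g24).  Key K1⁹ `stmt-QuantumFields-27364`, `--kind proof --supports … --as helper`; count-neutral.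
COMMISSIONED: plan g91 YMPLAN WORD N12 LOCATED-E1-HSB (pub-ymgap INBOX l.45435, 2026-08-29) «(r1)+(r2) to the lane».  NEW leaf; CONSUMED BY NAME, nothing modified: this lane's ρ5b
`N12TowerProxiesOfClass` (`exists_boxProxy_of_plaqSmallOn`, `exists_towerProxy_of_mem_class_pos`, `feeds_subset_boxBonds`, `towerBox_lt_sitesPerDir`), step (r2)'s Literature leaf
`B15AveragingHolomorphicTowerRegion` (guard transfer `guardOn_towerRegion_of_feedsProxy`, `guardOn_towerRegion_zero`) and g11's `B15Prop1DatumSmall7AtZSequence.plaqSmallOn_qsstarGIter0_of_isBlockUnion`.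

WHY (lane memo `N12-UNIFORMITY-SPEC.md` §6).  N12's only undischarged node-level input (J0′) `hMin` has a producer in the tree (w1 lineage, `…MinimiserFamilyFromThm1AtBaseCentral`) that
displays, per base field, the two GLOBAL (0.4) guards `hsbQ : SmallBelow k (Q_k^{s*}(ext V_k))`, `hsbU : SmallBelow k U₀` — false for data rough off `Z`.  Step (r1) (`B15AveragingHolomorphicLocal`)
showed the implicit-function argument needs the guard only along the TOWER of each constrained bond; this file INHABITS those tower guards: for `U₀` from its (2.12) class (ρ5b's axial-gauge
tower proxies, transferred to `U₀` itself by two-block locality), and for any configuration plaquette-small on the tower box — the datum `Q_k^{s*}V` being so wherever `V` is plaquette-small on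
the `k`-blocks holding the box (`plaqSmallOn_qsstarGIter0_of_isBlockUnion`, [IV] p. 193 ll. 14–16).  These are the replacement texts for `hsbU` ∕ `hsbQ` in the additive «TP» twins of step (r3).

CONTENTS (namespace `Summit.QuantumFields.YangMills.BalabanUVNodes.N12TowerGuardsOfClass`; theorems only — no `def`, no `instance`, no `sorry`).
* §1 ★★ `guardOn_towerRegion_of_plaqSmallOn_towerBox` — class-free core: ANY `SU(N)` configuration `δ`-plaquette-small on a set containing the tower box plaquettes of a level-`j` bond
  (`1 ≤ j ≤ k`, `k + 1 ≤ m + K`), with the height's radius letter `hsbU` and the budget `(d−1)(6Lʲ−4)·δ ≤ ρ″`, is (0.4)-guarded along the tower of that bond below `j`.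
* §2 ★★★ `guardOn_towerRegion_of_mem_class_pos` · ★★★ `guardOn_towerRegion_bondsOf_Bj_of_mem_class` (`bondsOf` currency) · ★★★ `guardOn_towerRegion_Bj_of_mem_class` (enumerated) — every constrained bond `(j_i, c_i)` of `𝐁_k(Z)`: the tower guard of a configuration
  `U₀ ∈ U_k({Ω_j(Z)}, εreg)` ITSELF (ρ5b's displayed rows VERBATIM: `4L ≤ M₁`, `k + 1 ≤ m + K`, `LᵏM₁ ∣ 2L^{m+K}`, `0 ≤ εreg`, radius letter `hsbU`, floor `6(d−1)L·εreg ≤ ρ″`).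
* §3 ★★ `guardOn_towerRegion_qsstarGIter0_of_plaqSmallOn` — the DATUM: `V` `δ`-plaquette-small on `plaqsInside Y^{(k)}`, `Y` a union of `k`-blocks holding the four corners of the tower
  box plaquettes (`2 ≤ d`, `0 < δ`), radius letter and budget ⇒ the tower guard of `Q_k^{s*}V` at the bond.

HONEST FRAMING ∕ LOCATED.  Lattice bookkeeping and kernel calculus over landed modules; the radius `ρ″` is an ∃-constant per height (`Node00.exists_uniform_chartCurvature_sq_bound`, displayed as
the letter `hsbU`), the floors volume-free smallness conditions; the geometry placing the datum's tower boxes inside the `k`-blocks where `V` is regular is DISPLAYED (`hbox`), not proved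
here; the re-threading (r3) of the nine-file chart chain is NOT done here; nothing of Bałaban's asserted; count-neutral helper; N12 NOT discharged; K1⁹ NOT closed; counts unmoved; one
finite 𝕋⁴ programme at fixed ε — R4 closes the conditional finite-𝕋⁴ rung `BalabanLadder.UV` only; NOT continuum ∕ OS ∕ mass gap ∕ Clay.
-/

noncomputable section

open scoped BigOperators Matrix.Norms.L2Operator Topology

namespace Summit.QuantumFields.YangMills.BalabanUVNodes.N12TowerGuardsOfClass

open Literature.MathematicalPhysics.QuantumFieldTheory.Balaban1983to89
open T4Continuum (T4Family)
open B15DeterminingSets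
open B14.Eq213MaximalDomains (side)
open B14.Eq213DetSet (Bj maxDomT)
open B14.Eq22Determines (blockIter IsBlockUnion)
open B14.Eq216Concrete (feeds)
open B10Eq42TorusConstraint (bondsIn)
open B15Prop1Carrier (plaqsInside)
open BlockAveraging (Small blockAvg)
open ExpMeanLog (expMeanLogSU)
open T4AxialGaugeSmallField (boxPlaqs boxBonds)
open T4ReflectionCone (three_le_L)
open Node00 (Stage7Numerics SU coeField SmallBelow avOfRecord regMSCoPOfRecord constrCard constrEnum)
open Literature.MathematicalPhysics.QuantumFieldTheory.BalabanImbrieJaffe1984to88.BIJ85Eq453GaugeField (qsstarGIter0)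
open B15AveragingHolomorphicTowerRegion (guardOn_towerRegion_of_feedsProxy guardOn_towerRegion_zero)
open B15Prop1DatumSmall7AtZSequence (plaqSmallOn_qsstarGIter0_of_isBlockUnion)
open Summit.QuantumFields.YangMills.BalabanUVNodes.N12TowerProxiesOfClass
  (exists_boxProxy_of_plaqSmallOn exists_towerProxy_of_mem_class_pos feeds_subset_boxBonds towerBox_lt_sitesPerDir)

variable {F : T4Family} {N : ℕ} [NeZero N]

/-! ## §1  Class-free core: plaquette-small on the tower box ⇒ guarded along the tower -/

/-- ★★ **PLAQUETTE-SMALL ON THE TOWER BOX ⇒ (0.4)-GUARDED ALONG THE TOWER.**  For a level-`j` bond `c` (`1 ≤ j ≤ k`, `k + 1 ≤ m + K`) let `[lo, hi]` be its tower box (the coordinate box of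
half-width `3Lʲ − 3` (+2) about `ι_j c₋`, `N12TowerProxiesOfClass.feeds_subset_boxBonds`).  ANY `SU(N)` configuration `U₀` that is `δ`-plaquette-small on a set `S₀ ⊇ boxPlaqs lo hi` is guarded
along the tower of `c` — `Small (Ū^{j′} U₀) c′` for every `j′ < j` and every level-`(j′+1)` bond `c′` of the tower region `blockIter j ⁻¹' {c₋, c₊}` — given the height's radius letter `hsbU` and the
budget `(d−1)(6Lʲ−4)·δ ≤ ρ″`: ρ5b's box proxy (`exists_boxProxy_of_plaqSmallOn`: axial gauge, flatten off the box, gauge back) agrees with `U₀` on `boxBonds ⊇ feeds j c` and is globally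
small-below, and the guard transfers to `U₀` (`B15AveragingHolomorphicTowerRegion.guardOn_towerRegion_of_feedsProxy`).  Nothing is asked of `U₀` off the box.
[cite: Balaban1985Averaging, (19) p.21; Balaban1987RG1, (0.4) p.253, (0.21) p.256; Balaban1988Convergent, (2.11) p.256] -/
theorem guardOn_towerRegion_of_plaqSmallOn_towerBox (Kt : ℕ) {k : ℕ} (hkK : k + 1 ≤ (F.P Kt).m + (F.P Kt).K) {j : ℕ} (hj1 : 1 ≤ j) (hjk : j ≤ k)
    (c : PBond (F.P Kt) j) {S₀ : Set (Plaq (F.P Kt) 0)}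
    (hS₀ : (boxPlaqs (fun κ => (((embIter j c.src) κ).val : ℤ) - ((3 * (F.P Kt).L ^ j - 3 : ℕ) : ℤ))
      (fun κ => (((embIter j c.src) κ).val : ℤ) + ((3 * (F.P Kt).L ^ j - 3 : ℕ) : ℤ) + 2) : Set (Plaq (F.P Kt) 0)) ⊆ S₀)
    {δ : ℝ} (hδ0 : 0 ≤ δ) {U₀ : GaugeField (F.P Kt) 0 (SU N)} (hU : PlaqSmallOn S₀ δ U₀)
    {ρ'' : ℝ} (hsbU : ∀ V : GaugeField (F.P Kt) 0 (SU N), ‖coeField V - 1‖ ≤ ρ'' → SmallBelow (avOfRecord F N Kt) k V)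
    (hbudget : ((((F.P Kt).d - 1 : ℕ)) : ℝ) * ((6 * (F.P Kt).L ^ j - 4 : ℕ) : ℕ) * δ ≤ ρ'') :
    ∀ j', j' < j → ∀ c' : PBond (F.P Kt) (j' + 1), c' ∈ bondsIn (j' + 1) (blockIter j ⁻¹' ({c.src, c.tgt} : Set (Site (F.P Kt) j))) →
      Small expMeanLogSU (Averaging.iter (avOfRecord F N Kt) j' U₀) c' := by
  have hk : k ≤ (F.P Kt).m + (F.P Kt).K := by omega
  have hjK : j ≤ (F.P Kt).m + (F.P Kt).K := hjk.trans hk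
  obtain ⟨i, rfl⟩ : ∃ i, j = i + 1 := ⟨j - 1, by omega⟩
  -- the box is non-wrapping: side `6Lʲ − 4 < 2L^{m+K}`
  have hq : 1 ≤ (F.P Kt).L ^ (i + 1) := Nat.one_le_pow _ _ (F.P Kt).L_pos
  have hnb : ∀ κ, (fun κ => (((embIter (i + 1) c.src) κ).val : ℤ) + ((3 * (F.P Kt).L ^ (i + 1) - 3 : ℕ) : ℤ) + 2) κ ≤
      (fun κ => (((embIter (i + 1) c.src) κ).val : ℤ) - ((3 * (F.P Kt).L ^ (i + 1) - 3 : ℕ) : ℤ)) κ + ((6 * (F.P Kt).L ^ (i + 1) - 4 : ℕ) : ℕ) := fun κ => by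
    simp only
    omega
  have hnN : 6 * (F.P Kt).L ^ (i + 1) - 4 < (F.P Kt).sitesPerDir 0 := towerBox_lt_sitesPerDir (F.P Kt) hkK hjk
  obtain ⟨U', hU', hsb'⟩ := exists_boxProxy_of_plaqSmallOn Kt hk hnb hnN hS₀ hδ0 hU hsbU hbudget
  have hsbj : SmallBelow (fun j => blockAvg (P := F.P Kt) (j := j) expMeanLogSU) (i + 1) U' := hsb'.mono hjk
  exact guardOn_towerRegion_of_feedsProxy hjK c hsbj fun b hb => hU' b (feeds_subset_boxBonds hjK c hb)

/-! ## §2  From the (2.12) class: the tower guards of `U₀` itself at the constrained bonds of `𝐁_k(Z)` -/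

/-- ★★★ **THE TOWER GUARD OF A POSITIVE-LEVEL CONSTRAINED BOND FROM THE CLASS**: for `1 ≤ j ≤ k` and `c` meeting `Γ_j(Z)`, a configuration `U₀ ∈ U_k({Ω_j(Z)}, εreg)` is ITSELF
(0.4)-guarded along the tower of `c` below `j` (ρ5b's `exists_towerProxy_of_mem_class_pos` transferred by two-block locality; rows as there).
[cite: Balaban1985Variational, (2) p.278, (82)–(83) p.290; Balaban1988Convergent, (2.2) p.255, (2.11)–(2.13) pp.256–257; Balaban1987RG1, (0.4) p.253] -/
theorem guardOn_towerRegion_of_mem_class_pos (ν : Stage7Numerics) (Kt : ℕ) {k : ℕ} (Z : Set (Site (F.P Kt) 0))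
    (hkK : k + 1 ≤ (F.P Kt).m + (F.P Kt).K) (hM4 : 4 * (F.P Kt).L ≤ ν.M₁) (hdiv : side (F.P Kt).L ν.M₁ k ∣ (F.P Kt).sitesPerDir 0)
    (hε : 0 ≤ ν.εreg) {ρ'' : ℝ} (hsbU : ∀ V : GaugeField (F.P Kt) 0 (SU N), ‖coeField V - 1‖ ≤ ρ'' → SmallBelow (avOfRecord F N Kt) k V)
    (hερ : 6 * ((((F.P Kt).d - 1 : ℕ)) : ℝ) * (F.P Kt).L * ν.εreg ≤ ρ'')
    {U₀ : GaugeField (F.P Kt) 0 (SU N)} (hU₀ : U₀ ∈ regMSCoPOfRecord F N ν Kt k (maxDomT ν.M₁ Z))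
    {j : ℕ} (hj1 : 1 ≤ j) (hjk : j ≤ k) {c : PBond (F.P Kt) j} (hc : c ∈ bondsOf (Bj ν.M₁ Z k j)) :
    ∀ j', j' < j → ∀ c' : PBond (F.P Kt) (j' + 1), c' ∈ bondsIn (j' + 1) (blockIter j ⁻¹' ({c.src, c.tgt} : Set (Site (F.P Kt) j))) →
      Small expMeanLogSU (Averaging.iter (avOfRecord F N Kt) j' U₀) c' := by
  have hjK : j ≤ (F.P Kt).m + (F.P Kt).K := by omega
  obtain ⟨i, rfl⟩ : ∃ i, j = i + 1 := ⟨j - 1, by omega⟩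
  obtain ⟨U', hU', hsb'⟩ := exists_towerProxy_of_mem_class_pos ν Kt Z hkK hM4 hdiv hε hsbU hερ hU₀ hj1 hjk hc
  have hsbj : SmallBelow (fun j => blockAvg (P := F.P Kt) (j := j) expMeanLogSU) (i + 1) U' := hsb'.mono hjk
  exact guardOn_towerRegion_of_feedsProxy hjK c hsbj hU'

/-- ★★★ **THE TOWER GUARDS AT EVERY CONSTRAINED BOND OF `𝐁_k(Z)` FROM THE CLASS, `bondsOf` currency** — the replacement text for the w1 lineage's global letter `hsbU : SmallBelow k U₀`,
INHABITED for a configuration in the (2.12) class of record: for every `j ≤ k`, every `c ∈ bondsOf (𝐁_k(Z) j)`, every `j′ < j` and every level-`(j′+1)` bond `c′` of the tower region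
`blockIter j ⁻¹' {c₋, c₊}`, `Small (Ū^{j′} U₀) c′` (level `0`: vacuous; positive levels: `guardOn_towerRegion_of_mem_class_pos`).  Rows = ρ5b's `towerProxies_Bj_of_mem_class` VERBATIM.
This is the hypothesis `hg` of `B15AveragingHolomorphicTowerRegion.differentiableAt_iterMh_apply_of_guardOn_towerRegion` at each constrained bond.
[cite: Balaban1985Variational, (2) p.278, (82)–(83) p.290, Prop. 9 (190) p.309; Balaban1988Convergent, (2.2) p.255, (2.10)–(2.13) pp.256–257; Balaban1987RG1, (0.4) p.253, (0.21) p.256] -/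
theorem guardOn_towerRegion_bondsOf_Bj_of_mem_class (ν : Stage7Numerics) (Kt : ℕ) {k : ℕ} (Z : Set (Site (F.P Kt) 0))
    (hkK : k + 1 ≤ (F.P Kt).m + (F.P Kt).K) (hM4 : 4 * (F.P Kt).L ≤ ν.M₁) (hdiv : side (F.P Kt).L ν.M₁ k ∣ (F.P Kt).sitesPerDir 0)
    (hε : 0 ≤ ν.εreg) {ρ'' : ℝ} (hsbU : ∀ V : GaugeField (F.P Kt) 0 (SU N), ‖coeField V - 1‖ ≤ ρ'' → SmallBelow (avOfRecord F N Kt) k V)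
    (hερ : 6 * ((((F.P Kt).d - 1 : ℕ)) : ℝ) * (F.P Kt).L * ν.εreg ≤ ρ'')
    {U₀ : GaugeField (F.P Kt) 0 (SU N)} (hU₀ : U₀ ∈ regMSCoPOfRecord F N ν Kt k (maxDomT ν.M₁ Z)) :
    ∀ j, j ≤ k → ∀ c : PBond (F.P Kt) j, c ∈ bondsOf (Bj ν.M₁ Z k j) →
      ∀ j', j' < j → ∀ c' : PBond (F.P Kt) (j' + 1), c' ∈ bondsIn (j' + 1) (blockIter j ⁻¹' ({c.src, c.tgt} : Set (Site (F.P Kt) j))) →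
        Small expMeanLogSU (Averaging.iter (avOfRecord F N Kt) j' U₀) c' := by
  intro j hj c hc
  rcases Nat.eq_zero_or_pos j with rfl | hj1
  · exact guardOn_towerRegion_zero c U₀
  · exact guardOn_towerRegion_of_mem_class_pos ν Kt Z hkK hM4 hdiv hε hsbU hερ hU₀ hj1 hj hc

/-- ★★★ **THE SAME, ENUMERATED** (`Node00.constrEnum` currency, the index of the datum coordinates `κ`): for every `i : Fin (constrCard (𝐁_k(Z)) k)` the tower guard of `U₀` at the
constrained bond `(j_i, c_i) = (constrEnum …).symm i`. [cite: Balaban1985Variational, (2) p.278, Prop. 9 (190) p.309; Balaban1988Convergent, (2.2) p.255, (2.10)–(2.13) pp.256–257; Balaban1987RG1, (0.4) p.253] -/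
theorem guardOn_towerRegion_Bj_of_mem_class (ν : Stage7Numerics) (Kt : ℕ) {k : ℕ} (Z : Set (Site (F.P Kt) 0))
    (hkK : k + 1 ≤ (F.P Kt).m + (F.P Kt).K) (hM4 : 4 * (F.P Kt).L ≤ ν.M₁) (hdiv : side (F.P Kt).L ν.M₁ k ∣ (F.P Kt).sitesPerDir 0)
    (hε : 0 ≤ ν.εreg) {ρ'' : ℝ} (hsbU : ∀ V : GaugeField (F.P Kt) 0 (SU N), ‖coeField V - 1‖ ≤ ρ'' → SmallBelow (avOfRecord F N Kt) k V)
    (hερ : 6 * ((((F.P Kt).d - 1 : ℕ)) : ℝ) * (F.P Kt).L * ν.εreg ≤ ρ'')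
    {U₀ : GaugeField (F.P Kt) 0 (SU N)} (hU₀ : U₀ ∈ regMSCoPOfRecord F N ν Kt k (maxDomT ν.M₁ Z)) :
    ∀ i : Fin (constrCard (Bj ν.M₁ Z k) k), ∀ j', j' < (((constrEnum (Bj ν.M₁ Z k) k).symm i).1 : ℕ) →
      ∀ c' : PBond (F.P Kt) (j' + 1),
        c' ∈ bondsIn (j' + 1) (blockIter (((constrEnum (Bj ν.M₁ Z k) k).symm i).1 : ℕ)
          ⁻¹' ({((constrEnum (Bj ν.M₁ Z k) k).symm i).2.1.src, ((constrEnum (Bj ν.M₁ Z k) k).symm i).2.1.tgt} :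
            Set (Site (F.P Kt) ((constrEnum (Bj ν.M₁ Z k) k).symm i).1))) →
          Small expMeanLogSU (Averaging.iter (avOfRecord F N Kt) j' U₀) c' := fun i =>
  guardOn_towerRegion_bondsOf_Bj_of_mem_class ν Kt Z hkK hM4 hdiv hε hsbU hερ hU₀ _
    (Nat.le_of_lt_succ ((constrEnum (Bj ν.M₁ Z k) k).symm i).1.2) _ ((constrEnum (Bj ν.M₁ Z k) k).symm i).2.2

/-! ## §3  The datum: the tower guards of the pull-back `Q_k^{s*}V` wherever `V` is plaquette-small -/

/-- ★★ **THE TOWER GUARD OF THE PULL-BACK DATUM** — the replacement text for the w1 lineage's global letter `hsbQ : SmallBelow k (Q_k^{s*}Ṽ_k)`, INHABITED from scale-`k` plaquette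
smallness: if `V` is `δ`-plaquette-small on the scale-`k` plaquettes inside `Y^{(k)}` for a union of `k`-blocks `Y` containing the four corners of every plaquette of the tower box of a
level-`j` bond `c` (`1 ≤ j ≤ k`), then — [IV] p. 193 ll. 14–16: the fine plaquette variables of `Q_k^{s*}V` are `1` or block plaquette variables of `V` (g11's
`plaqSmallOn_qsstarGIter0_of_isBlockUnion`) — the datum `Q_k^{s*}V` is (0.4)-guarded along the tower of `c` below `j` (§1), given the radius letter and the budget `(d−1)(6Lʲ−4)·δ ≤ ρ″`.
The geometry `hbox` (at the record: the tower boxes of the positive-level bonds of `𝐁_k(Z)` lie inside `Z`, where the p. 193 extension `Ṽ_k` is regular) is DISPLAYED.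
[cite: Balaban1989LargeFieldI, (1.74) p.192, p.193 L14–16; BalabanImbrieJaffe1985, (4.5.3) p.312; Balaban1987RG1, (0.4) p.253, (0.21) p.256; Balaban1988Convergent, (2.11) p.256] -/
theorem guardOn_towerRegion_qsstarGIter0_of_plaqSmallOn (Kt : ℕ) (hd : 2 ≤ (F.P Kt).d) {k : ℕ} (hkK : k + 1 ≤ (F.P Kt).m + (F.P Kt).K)
    {j : ℕ} (hj1 : 1 ≤ j) (hjk : j ≤ k) (c : PBond (F.P Kt) j) {Y : Set (Site (F.P Kt) 0)} (hY : IsBlockUnion k Y)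
    (hbox : (boxPlaqs (fun κ => (((embIter j c.src) κ).val : ℤ) - ((3 * (F.P Kt).L ^ j - 3 : ℕ) : ℤ))
      (fun κ => (((embIter j c.src) κ).val : ℤ) + ((3 * (F.P Kt).L ^ j - 3 : ℕ) : ℤ) + 2) : Set (Plaq (F.P Kt) 0)) ⊆ plaqsInside Y)
    {δ : ℝ} (hδ : 0 < δ) {V : GaugeField (F.P Kt) k (SU N)} (hV : PlaqSmallOn (plaqsInside (pts k Y)) δ V)
    {ρ'' : ℝ} (hsbU : ∀ V : GaugeField (F.P Kt) 0 (SU N), ‖coeField V - 1‖ ≤ ρ'' → SmallBelow (avOfRecord F N Kt) k V)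
    (hbudget : ((((F.P Kt).d - 1 : ℕ)) : ℝ) * ((6 * (F.P Kt).L ^ j - 4 : ℕ) : ℕ) * δ ≤ ρ'') :
    ∀ j', j' < j → ∀ c' : PBond (F.P Kt) (j' + 1), c' ∈ bondsIn (j' + 1) (blockIter j ⁻¹' ({c.src, c.tgt} : Set (Site (F.P Kt) j))) →
      Small expMeanLogSU (Averaging.iter (avOfRecord F N Kt) j' (qsstarGIter0 k V)) c' :=
  guardOn_towerRegion_of_plaqSmallOn_towerBox Kt hkK hj1 hjk c subset_rfl hδ.le
    (plaqSmallOn_qsstarGIter0_of_isBlockUnion hd (by omega) hY hbox hδ hV) hsbU hbudget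

end Summit.QuantumFields.YangMills.BalabanUVNodes.N12TowerGuardsOfClass

end
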